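import Literature.NumberTheory.EllipticCurves.HeegnerPointsHeckeOrbit
import Literature.NumberTheory.EllipticCurves.HeegnerPointsLevelTransportOrders
import HarnessLib

/-!
# `Aut(ℂ/K[f])` is transitive on the Hecke neighbours of a CM point of conductor `f` on `Y₀(N)` —
# Gross 1991 §3 / Nekovář 2007 Prop. 4.8 WITHOUT `gcd(N, d_K) = 1` (level-`N` Heegner forms of an
# arbitrary order, Bezout form)

Topic `NumberTheory/EllipticCurves` (complex multiplication; sequel of `HeegnerPointsHeckeOrbit`,
`HeegnerPointsLevelTransportOrders`, `RingClassFieldGenerator`), namespace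
`Literature.NumberTheory.EllipticCurves`.  Theorems only: no definition, no named fact (D-0026);
unconditional; nothing depends on an auxiliary prime (the prime here is the Kolyvagin prime `ℓ`,
inert in `K`, `ℓ ∤ N f`).

`HeegnerPointsHeckeOrbit.lean` proves, for Gross's Heegner point `x(m) = heegnerPointOfConductor d_K β m`
(CM by the order `𝒪_m`, `gcd(N, m d_K) = 1`, `4N ∣ β² − d_K`), that `Aut(ℂ/K[m])` acts (simply)
transitively on the `ℓ + 1` points of the Hecke divisor `T_ℓ(x(m))` and carries `x(ℓm)` onto each of
them — Gross 1991, proof of Prop. 3.7: *"the points in the divisor `T_ℓ(x_m)` are the conjugates of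
`x_n` over `K_m`"* (PDF p. 218 L5–6).  The hypothesis `gcd(N, d_K) = 1` enters there ONLY through the
lattice sandwich of `HeegnerPointsLevelTransport.lean`; `HeegnerPointsLevelTransportOrders.lean` runs
the same engine under the Bezout identity `uN + vβ + wc = 1`, `4Nc = β² − D`, for a level-`N`
Heegner form `Q` of ANY negative discriminant `D` (`levelTransport_self_of_apply_formJ_eq_bezout`;
Gross 1984 §I.1: Heegner points `(𝒪, 𝔫, [𝔞])` of an arbitrary order `𝒪` with `𝒪/𝔫 ≅ ℤ/N`).

This file re-runs the COUNTING argument of `HeegnerPointsHeckeOrbit.lean` in that generality.  The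
base point is any `x ∈ ℍ` whose point of `Y₀(N)` is fixed by `Aut(ℂ/K[f])` in transport form
(`hfix : ∀ σ, σ|_{K[f]} = id → LevelTransport N σ x x`; supplied for `x = τ_Q`, `Q` a level-`N`
Heegner form of discriminant `f² d_K` with Bezout data, by
`levelTransport_self_of_fix_ringClassField_bezout`), and the moving point is `τ_{Q'}` for any
PRIMITIVE positive definite form `Q'` of discriminant `(ℓf)² d_K` that is a Hecke `ℓ`-neighbour of `x`
(e.g. `x/ℓ`, the root of `(ℓ²A, ℓB, C)`).  Then:

1. `K[ℓf] = K(j(τ_{Q'}))` (Cox Thm. 11.1 (ii), the tree's form-level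
   `adjoin_formJ_toSubfield_eq_ringClassField`), so `ℓ + 1 = [K[ℓf] : K[f]]` automorphisms of `ℂ`
   over `K[f]` separate `j(τ_{Q'})` (`exists_ringEquiv_fix_ringClassField_injective_of_formJ`);
2. each of them carries `τ_{Q'}` INTO `T_ℓ(x)` (`hfix` + `IsHeckeNeighbour.exists_levelTransport`),
   whose `j`-values form a set of at most `ℓ + 1` elements (`card_kleinJ_heckeNeighbours_le`);
3. hence the orbit fills `T_ℓ(x)`: the `ℓ + 1` points of `T_ℓ(x)` have pairwise distinct
   `j`-invariants, two neighbours with the same `j` are `Γ₀(N)`-equivalent, and EVERY Hecke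
   `ℓ`-neighbour of `x` is the `LevelTransport`-image of `τ_{Q'}` under some `σ ∈ Aut(ℂ/K[f])`
   (this file stops at the COUNT `exists_image_kleinJ_eq_kleinJ_heckeNeighbours_of_fix` /
   `card_kleinJ_heckeNeighbours_of_fix`; the consequences — distinct `j`-invariants, `Γ₀(N)`-equivalence,
   TRANSITIVITY `exists_ringEquiv_levelTransport_of_isHeckeNeighbour_of_fix` and its uniqueness half —
   are the sibling file `HeegnerPointsHeckeOrbitOrdersTransitive.lean`, split off for size).

In print this is Nekovář 2007, Prop. (4.8) (ii) *"`T(ℓ) x(𝔫) = u(r) Σ_σ σ(x(𝔫ℓ))`"* for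
`B = M₂(ℚ)`, `H = Γ̂₀(N)` and CM points by an arbitrary order (`u(r) = 1` as soon as
`𝒪_{c}^× = 𝒪_{cℓ}^×`, i.e. `f ≥ 2` or `d_K < −4` — the hypothesis `hunits`), and Gross 1991 Prop. 3.7's
Galois half; for `3 ∣ gcd(N, f)` (Hu–Shu–Yin 2019: `N = 3⁵`, `K = ℚ(√−3)`, conductor `9p`) no tree
theorem covered it.  What is NOT here: the point `x/ℓ` itself (`HeegnerFormsConductorMul.lean`), the
passage to `y = φ(x)` and the trace relation `Tr y' = a_ℓ y` (`HeegnerTraceRelationOrdersProofs.lean`).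

## References

* B. H. Gross, *Kolyvagin's work on modular elliptic curves*, LMS LNS 153 (1991), §3, proof of
  Prop. 3.7 (PDF p. 217 L24–26, p. 218 L5–6 of `book:editornd-l-functions-arithmetic`). [GrossLMS1991]
* J. Nekovář, *The Euler system method for CM points on Shimura curves*, LMS LNS 320 (2007),
  (4.5)–(4.8) (PDF p. 0566–0570 of `book:burns2007-l-functions-galois-representations`). [Nekovar2007]
* B. H. Gross, *Heegner points on `X₀(N)`*, 1984, §I.1. [Gross1984]
* H. Darmon, *Rational points on modular elliptic curves*, CBMS 101 (2004), Prop. 3.10. [Darmon2004]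
* D. A. Cox, *Primes of the form x² + ny²*, 2nd ed. (2013), Thm. 11.1, §12.A. [Cox2013]

## Mathlib / tree search

Tree (all Literature, by name): `levelTransport_self_of_apply_formJ_eq_bezout`
(`HeegnerPointsLevelTransportOrders`); `formJ_mem_ringClassField`, `apply_mem_ringClassField`,
`finiteDimensional_and_isGalois_ringClassField` (`HeegnerPointsOfConductor`);
`adjoin_formJ_toSubfield_eq_ringClassField`, `exists_ringEquiv_apply_eq_algEquiv`
(`RingClassFieldGenerator`); `RingClassField.finrank_subfieldIn_ringClassField_eq_succ`
(`RingClassFieldTower`); `apply_sqrtDisc_discr_eq` (`HeegnerPointsShimuraReduction`);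
`IsHeckeNeighbour.exists_levelTransport`, `kleinJ_mem_of_isHeckeNeighbour`, `card_kleinJ_heckeNeighbours_le`,
`exists_gamma0_smul_eq_of_isHeckeNeighbour`, `LevelTransport.kleinJ_eq`,
`LevelTransport.of_gamma0_smul_eq_right` (`HeckeNeighbourTransport`, `LevelStructureTransport`);
`formJ_eq_kleinJ`.  The `heegnerPointOfConductor` statements being generalised:
`exists_ringEquiv_fix_ringClassField_injective`, `exists_image_kleinJ_eq_kleinJ_heckeNeighbours`,
`exists_gamma0_smul_eq_of_kleinJ_eq`, `exists_ringEquiv_levelTransport_of_isHeckeNeighbour`,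
`eqOn_ringClassField_of_levelTransport_of_gamma0_smul_eq` (`HeegnerPointsHeckeOrbit`), whose proofs
are followed here step for step.  `lean search 'of_formJ|HeckeOrbitOrders|_of_fix_ringClassField_bezout'`
→ nothing before this file.
presearch: Gross's two lines [corpus:book:editornd-l-functions-arithmetic p0217:L24–26, p0218:L5–6];
Nekovář (4.8) [corpus:book:burns2007-l-functions-galois-representations p0570]; galaxy
"Hecke orbit|ring class field|CM point" not needed beyond the held texts (port of tree proofs).
-/

noncomputable section

open Complex UpperHalfPlane CongruenceSubgroup PeriodPair NumberField
open scoped MatrixGroups IntermediateField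

namespace Literature.NumberTheory.EllipticCurves

open Literature.NumberTheory.EllipticCurves.ModularForms
  Literature.NumberTheory.QuadraticFields.BinaryQuadraticForm
  Literature.NumberTheory.QuadraticFields.Quadratic

variable {K : Type} [Field K] [NumberField K]

/-! ### Forms of discriminant `f² d_K`: membership of `j` in `K[f]`, and `K[f] = K(j)` -/

/-- `√(f²D) = f√D` for the normalised square roots `sqrtDisc` (`f ≥ 0`). Private helper. [folklore] -/
private theorem sqrtDisc_sq_mul' (D : ℤ) (f : ℕ) :
    sqrtDisc ((f : ℤ) ^ 2 * D) = (f : ℂ) * sqrtDisc D := by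
  unfold sqrtDisc
  have hf : (0 : ℝ) ≤ f := Nat.cast_nonneg f
  have h : -(((f : ℤ) ^ 2 * D : ℤ) : ℝ) = (f : ℝ) ^ 2 * (-(D : ℝ)) := by push_cast; ring
  rw [h, Real.sqrt_mul (sq_nonneg _), Real.sqrt_sq hf]
  push_cast
  ring

/-- `f² d_K < 0` for `f ≠ 0`. Private helper. [folklore] -/
private theorem conductor_sq_mul_discr_neg (hK : IsImaginaryQuadratic K) {f : ℕ} (hf : f ≠ 0) :
    (f : ℤ) ^ 2 * NumberField.discr K < 0 :=
  mul_neg_of_pos_of_neg (pow_pos (by exact_mod_cast Nat.pos_of_ne_zero hf) 2) hK.discr_neg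

/-- The primitivity clause of `heegnerForms` is the tree's `IsPrimitive`. Private helper. [folklore] -/
private theorem isPrimitive_of_mem_heegnerForms {N : ℕ} {D : ℤ} {Q : ℤ × ℤ × ℤ}
    (hQ : Q ∈ heegnerForms N D) : IsPrimitive Q :=
  (isPrimitive_iff_binQF _).mpr ((BinQF.isPrimitive_iff _).mpr hQ.2.2.2)

/-- **`j(τ_Q) ∈ K[f]` for a level-`N` Heegner form `Q` of discriminant `f² d_K`** (any order; Cox
Thm. 11.1 through the tree's `formJ_mem_ringClassField`). [cite: Cox2013, §11.A Thm. 11.1] -/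
theorem kleinJ_heegnerTau_mem_ringClassField_of_mem_heegnerForms (hK : IsImaginaryQuadratic K)
    (ι : K →+* ℂ) {N f : ℕ} (hf : f ≠ 0) {Q : ℤ × ℤ × ℤ}
    (hQ : Q ∈ heegnerForms N ((f : ℤ) ^ 2 * NumberField.discr K)) :
    kleinJ (heegnerTau Q) ∈ ringClassField K ι f := by
  rw [← formJ_eq_kleinJ]
  exact formJ_mem_ringClassField ι hQ.2.1 (isPrimitive_of_mem_heegnerForms hQ) hQ.1
    (conductor_sq_mul_discr_neg hK hf)

/-- **`K[f]` is generated over `ι(K)` by `j(τ_Q)`** for EVERY primitive positive definite form `Q` of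
discriminant `f² d_K` (Cox Thm. 11.1 (ii): `K(j(𝔞)) = ` the ring class field of `𝒪_f` for every
proper `𝒪_f`-ideal `𝔞`; the tree's `adjoin_formJ_toSubfield_eq_ringClassField` in closure form for an
explicit `ι`). [cite: Cox2013, §11.A Thm. 11.1] -/
theorem closure_range_union_formJ_eq_ringClassField (hK : IsImaginaryQuadratic K) (ι : K →+* ℂ)
    {f : ℕ} (hf : f ≠ 0) {Q : ℤ × ℤ × ℤ} (hQ1 : 0 < Q.1) (hprim : IsPrimitive Q)
    (hdisc : discr Q = (f : ℤ) ^ 2 * NumberField.discr K) :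
    Subfield.closure (Set.range ι ∪ {formJ Q}) = ringClassField K ι f := by
  letI : Algebra K ℂ := ι.toAlgebra
  have h := adjoin_formJ_toSubfield_eq_ringClassField (K := K) hK hf hQ1 hprim hdisc
  rw [IntermediateField.adjoin_toSubfield] at h
  exact h

/-- **Two ring homomorphisms `ℂ → ℂ` that agree on `ι(K)` and at `j(τ_Q)` agree on `K[f]`**, for
any primitive positive definite `Q` of discriminant `f² d_K` (generator + `RingHom.eqOn_field_closure`).
[cite: Cox2013, §11.A Thm. 11.1] -/
theorem eqOn_ringClassField_of_apply_formJ_eq (hK : IsImaginaryQuadratic K) (ι : K →+* ℂ)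
    {f : ℕ} (hf : f ≠ 0) {Q : ℤ × ℤ × ℤ} (hQ1 : 0 < Q.1) (hprim : IsPrimitive Q)
    (hdisc : discr Q = (f : ℤ) ^ 2 * NumberField.discr K)
    {φ ψ : ℂ →+* ℂ} (hKφψ : ∀ k : K, φ (ι k) = ψ (ι k)) (hj : φ (formJ Q) = ψ (formJ Q)) :
    Set.EqOn φ ψ (ringClassField K ι f) := by
  rw [← closure_range_union_formJ_eq_ringClassField hK ι hf hQ1 hprim hdisc]
  apply RingHom.eqOn_field_closure
  rintro x (⟨k, rfl⟩ | hx)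
  · exact hKφψ k
  · rw [Set.mem_singleton_iff] at hx
    subst hx
    exact hj

/-! ### The `ℓ + 1` automorphisms of `ℂ` over `K[f]` separating `j(τ_{Q'})`, `disc Q' = (ℓf)² d_K` -/

/-- **The `ℓ + 1` automorphisms of `ℂ` over `K[f]` separating `j(τ_{Q'})`** for ANY primitive
positive definite form `Q'` of discriminant `(ℓf)² d_K` (`ℓ` prime inert in `K`, `ℓ ∤ f`, `f ≥ 1`,
and `f ≥ 2` or `d_K < −4`): `[K[ℓf] : K[f]] = ℓ + 1` (`finrank_subfieldIn_ringClassField_eq_succ`),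
the elements of `Gal(K[ℓf]/K[f])` are separated by their values at the generator `j(τ_{Q'})` of
`K[ℓf]` over `K`, and each extends to `ℂ` (`exists_ringEquiv_apply_eq_algEquiv`).  Form-level twin of
`exists_ringEquiv_fix_ringClassField_injective`; Gross 1991 §3: `#G_ℓ = ℓ + 1`.
[cite: GrossLMS1991, §3 (PDF p. 217 l. 1–3)] [cite: Cox2013, §11.A Thm. 11.1] -/
theorem exists_ringEquiv_fix_ringClassField_injective_of_formJ (hK : IsImaginaryQuadratic K)
    (ι : K →+* ℂ) {ℓ f : ℕ} (hℓ : ℓ.Prime) (hinert : (Ideal.span {(ℓ : 𝓞 K)}).IsPrime)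
    (hℓf : ¬ ℓ ∣ f) (hf : f ≠ 0) (hunits : 2 ≤ f ∨ NumberField.discr K < -4)
    {Q' : ℤ × ℤ × ℤ} (hQ'1 : 0 < Q'.1) (hQ'prim : IsPrimitive Q')
    (hQ'disc : discr Q' = ((ℓ * f : ℕ) : ℤ) ^ 2 * NumberField.discr K) :
    ∃ σ : Fin (ℓ + 1) → (ℂ ≃+* ℂ), (∀ i, ∀ x ∈ ringClassField K ι f, σ i x = x) ∧
      Function.Injective fun i => σ i (kleinJ (heegnerTau Q')) := by
  letI : Algebra K ℂ := ι.toAlgebra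
  have hn : ℓ * f ≠ 0 := mul_ne_zero hℓ.ne_zero hf
  haveI := (finiteDimensional_and_isGalois_ringClassField hK ι hn).1
  haveI := (finiteDimensional_and_isGalois_ringClassField hK ι hn).2
  haveI : IsGalois (RingClassField.subfieldIn ι (ℓ * f) f) (ringClassField K ι (ℓ * f)) :=
    IsGalois.tower_top_of_isGalois K _ _
  haveI : FiniteDimensional (RingClassField.subfieldIn ι (ℓ * f) f) (ringClassField K ι (ℓ * f)) :=
    Module.Finite.of_restrictScalars_finite K _ _
  have hcard : Nat.card (ringClassField K ι (ℓ * f) ≃ₐ[RingClassField.subfieldIn ι (ℓ * f) f]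
      ringClassField K ι (ℓ * f)) = ℓ + 1 := by
    rw [IsGalois.card_aut_eq_finrank]
    exact RingClassField.finrank_subfieldIn_ringClassField_eq_succ hK ι hℓ hinert hℓf hf hunits
  haveI : Finite (ringClassField K ι (ℓ * f) ≃ₐ[RingClassField.subfieldIn ι (ℓ * f) f]
      ringClassField K ι (ℓ * f)) :=
    Nat.finite_of_card_ne_zero (by rw [hcard]; exact Nat.succ_ne_zero ℓ)
  -- extend every `g ∈ Gal(K[ℓf]/K[f])` to `ℂ`
  have hext := fun g : ringClassField K ι (ℓ * f) ≃ₐ[RingClassField.subfieldIn ι (ℓ * f) f]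
      ringClassField K ι (ℓ * f) =>
    exists_ringEquiv_apply_eq_algEquiv hK ι (dvd_mul_left f ℓ) hn g
  choose sg hsgfix hsg using hext
  let e : Fin (ℓ + 1) ≃ (ringClassField K ι (ℓ * f) ≃ₐ[RingClassField.subfieldIn ι (ℓ * f) f]
      ringClassField K ι (ℓ * f)) :=
    ((Finite.equivFin _).trans (finCongr hcard)).symm
  refine ⟨fun i => sg (e i), fun i => hsgfix (e i), ?_⟩
  -- injectivity: automorphisms agreeing at the generator `j(τ_{Q'})` agree on `K[ℓf]`
  intro i i' hii'
  simp only at hii'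
  rw [← formJ_eq_kleinJ] at hii'
  suffices h : e i = e i' from e.injective h
  have hEq : Set.EqOn (sg (e i)).toRingHom (sg (e i')).toRingHom (ringClassField K ι (ℓ * f)) :=
    eqOn_ringClassField_of_apply_formJ_eq hK ι hn hQ'1 hQ'prim hQ'disc
      (fun k => by
        change sg (e i) (ι k) = sg (e i') (ι k)
        rw [hsgfix (e i) _ (apply_mem_ringClassField ι f k),
          hsgfix (e i') _ (apply_mem_ringClassField ι f k)])
      hii'
  ext x
  have hx := hEq x.2
  change sg (e i) x = sg (e i') x at hx
  rw [hsg (e i) x, hsg (e i') x] at hx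
  exact hx

/-! ### `Aut(ℂ/K[f])` fixes the point `τ_Q` of `Y₀(N)` — Bezout form -/

/-- **Every `σ ∈ Aut(ℂ/K[f])` fixes the CM point `τ_Q` of `Y₀(N)`** for a level-`N` Heegner form `Q`
of discriminant `f² d_K` with Bezout data (`B ≡ β (mod 2N)`, `4Nc = β² − f²d_K`, `uN + vβ + wc = 1`):
`σ` transports the level-`N` structure `(Λ_{τ_Q}, Λ_{Nτ_Q})` to itself.  Indeed `σ` fixes
`ι(K) ⊆ K[f]`, hence `√(f²d_K) = f√d_K` (`apply_sqrtDisc_discr_eq`), and fixes `j(τ_Q) ∈ K[f]`, so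
the Bezout engine `levelTransport_self_of_apply_formJ_eq_bezout` applies.  Twin of
`levelTransport_self_of_fix_ringClassField` without `gcd(N, d_K) = 1` (Gross 1984 §I.1: Heegner
points `(𝒪_f, 𝔫, [𝔞])` are rational over the ring class field of `𝒪_f`).
[cite: Gross1984, §I.1] [cite: GrossLMS1991, §3 (x_n rational over K_n)] -/
theorem levelTransport_self_of_fix_ringClassField_bezout (hK : IsImaginaryQuadratic K) (ι : K →+* ℂ)
    {N : ℕ} [NeZero N] {f : ℕ} (hf : f ≠ 0) {Q : ℤ × ℤ × ℤ}
    (hQ : Q ∈ heegnerForms N ((f : ℤ) ^ 2 * NumberField.discr K)) {β c u v w : ℤ}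
    (hβ : Q.2.1 ≡ β [ZMOD 2 * N]) (hc : 4 * N * c = β ^ 2 - (f : ℤ) ^ 2 * NumberField.discr K)
    (huvw : u * N + v * β + w * c = 1) {σ : ℂ ≃+* ℂ}
    (hσ : ∀ x ∈ ringClassField K ι f, σ x = x) :
    LevelTransport N σ (heegnerTau Q) (heegnerTau Q) := by
  have hD := conductor_sq_mul_discr_neg hK hf
  have hσK : ∀ k : K, σ (ι k) = ι k := fun k => hσ _ (apply_mem_ringClassField ι f k)
  have hsqrt : σ (sqrtDisc ((f : ℤ) ^ 2 * NumberField.discr K)) =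
      sqrtDisc ((f : ℤ) ^ 2 * NumberField.discr K) := by
    rw [sqrtDisc_sq_mul', map_mul, map_natCast, apply_sqrtDisc_discr_eq hK ι hσK]
  have hj : σ (formJ Q) = formJ Q := by
    rw [formJ_eq_kleinJ]
    exact hσ _ (kleinJ_heegnerTau_mem_ringClassField_of_mem_heegnerForms hK ι hf hQ)
  exact levelTransport_self_of_apply_formJ_eq_bezout hD hc huvw hsqrt hQ hβ hj

/-! ### The orbit of `j(τ_{Q'})` under `Aut(ℂ/K[f])` lies in the `j`-values of `T_ℓ(x)` -/

section Orbit

variable {N : ℕ} [NeZero N]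

/-- **`Aut(ℂ/K[f])` carries a Hecke neighbour `x'` of a `K[f]`-rational point `x` of `Y₀(N)` into
`T_ℓ(x)`**: if every `σ ∈ Aut(ℂ/K[f])` fixes the point `x` of `Y₀(N)` (`hfix`, transport form) and
`x'` is a Hecke `ℓ`-neighbour of `x` (`ℓ ∤ N`), then for such `σ` there is a Hecke `ℓ`-neighbour `τ₁'`
of `x` with `LevelTransport N σ x' τ₁'` — the Hecke correspondence commutes with `Aut(ℂ)`
(`IsHeckeNeighbour.exists_levelTransport`).  Gross 1991, §3: the conjugates of `x_n` over `K_m` lie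
in `T_ℓ(x_m)`. [cite: GrossLMS1991, §3 (proof of Prop. 3.7, PDF p. 217–218)] -/
theorem exists_isHeckeNeighbour_levelTransport_of_fix' (ι : K →+* ℂ) {f ℓ : ℕ} (hℓ : ℓ.Prime)
    (hℓN : ¬ ℓ ∣ N) {x x' : ℍ}
    (hfix : ∀ σ : ℂ ≃+* ℂ, (∀ z ∈ ringClassField K ι f, σ z = z) → LevelTransport N σ x x)
    (hx' : IsHeckeNeighbour N ℓ x x') {σ : ℂ ≃+* ℂ} (hσ : ∀ z ∈ ringClassField K ι f, σ z = z) :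
    ∃ τ₁' : ℍ, IsHeckeNeighbour N ℓ x τ₁' ∧ LevelTransport N σ x' τ₁' := by
  haveI : NeZero ℓ := ⟨hℓ.ne_zero⟩
  exact hx'.exists_levelTransport hℓ hℓN (hfix σ hσ)

/-- Consequently `σ(j(x'))` is the `j`-invariant of a point of `T_ℓ(x)`: it lies in the finite set
`{j((x + j)/ℓ) : 0 ≤ j < ℓ} ∪ {j(ℓ x)}`. [cite: GrossLMS1991, §3 (proof of Prop. 3.7, PDF p. 217–218)] -/
theorem apply_kleinJ_mem_kleinJ_heckeNeighbours_of_fix (ι : K →+* ℂ) {f ℓ : ℕ} (hℓ : ℓ.Prime)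
    (hℓN : ¬ ℓ ∣ N) [NeZero ℓ] {x x' : ℍ}
    (hfix : ∀ σ : ℂ ≃+* ℂ, (∀ z ∈ ringClassField K ι f, σ z = z) → LevelTransport N σ x x)
    (hx' : IsHeckeNeighbour N ℓ x x') {σ : ℂ ≃+* ℂ} (hσ : ∀ z ∈ ringClassField K ι f, σ z = z) :
    σ (kleinJ x') ∈
      (Finset.range ℓ).image (fun j : ℕ => kleinJ (tpB ℓ (j : ℤ) • x)) ∪ {kleinJ (tpD ℓ • x)} := by
  obtain ⟨τ₁', h₁, h₂⟩ := exists_isHeckeNeighbour_levelTransport_of_fix' ι hℓ hℓN hfix hx' hσ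
  rw [← h₂.kleinJ_eq]
  exact kleinJ_mem_of_isHeckeNeighbour hℓ hℓN h₁

/-! ### Counting: the orbit fills the `ℓ + 1` values, which are therefore distinct -/

/-- **The `Aut(ℂ/K[f])`-orbit of `j(τ_{Q'})` is exactly the set of `j`-values of `T_ℓ(x)`**, which
has `ℓ + 1` elements — for a `K[f]`-rational point `x` of `Y₀(N)` (`hfix`) and a Hecke `ℓ`-neighbour
`τ_{Q'}` of `x` with `Q'` primitive positive definite of discriminant `(ℓf)² d_K` (`ℓ` inert, `ℓ ∤ Nf`,
`f ≥ 2` or `d_K < −4`): the `ℓ + 1` distinct values `σ_i(j(τ_{Q'}))`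
(`exists_ringEquiv_fix_ringClassField_injective_of_formJ`) lie in a set of at most `ℓ + 1` elements.
Gross 1991, §3: `Tr_ℓ x_n = T_ℓ(x_m)` as divisors of degree `ℓ + 1`; Nekovář 2007 (4.8) (ii) with
`u(r) = 1`. [cite: GrossLMS1991, §3 (proof of Prop. 3.7, PDF p. 217–218)] [cite: Nekovar2007, Prop. (4.8) (ii) (p. 0570)] -/
theorem exists_image_kleinJ_eq_kleinJ_heckeNeighbours_of_fix (hK : IsImaginaryQuadratic K)
    (ι : K →+* ℂ) {f ℓ : ℕ} (hℓ : ℓ.Prime) (hinert : (Ideal.span {(ℓ : 𝓞 K)}).IsPrime)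
    (hℓN : ¬ ℓ ∣ N) (hℓf : ¬ ℓ ∣ f) (hf : f ≠ 0) (hunits : 2 ≤ f ∨ NumberField.discr K < -4)
    [NeZero ℓ] {x : ℍ}
    (hfix : ∀ σ : ℂ ≃+* ℂ, (∀ z ∈ ringClassField K ι f, σ z = z) → LevelTransport N σ x x)
    {Q' : ℤ × ℤ × ℤ} (hQ'1 : 0 < Q'.1) (hQ'prim : IsPrimitive Q')
    (hQ'disc : discr Q' = ((ℓ * f : ℕ) : ℤ) ^ 2 * NumberField.discr K)
    (hx' : IsHeckeNeighbour N ℓ x (heegnerTau Q')) :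
    ∃ σ : Fin (ℓ + 1) → (ℂ ≃+* ℂ), (∀ i, ∀ z ∈ ringClassField K ι f, σ i z = z) ∧
      (Function.Injective fun i => σ i (kleinJ (heegnerTau Q'))) ∧
      (Finset.univ.image fun i => σ i (kleinJ (heegnerTau Q'))) =
        (Finset.range ℓ).image (fun j : ℕ => kleinJ (tpB ℓ (j : ℤ) • x)) ∪ {kleinJ (tpD ℓ • x)} := by
  classical
  obtain ⟨σ, hσfix, hσinj⟩ :=
    exists_ringEquiv_fix_ringClassField_injective_of_formJ hK ι hℓ hinert hℓf hf hunits hQ'1 hQ'prim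
      hQ'disc
  refine ⟨σ, hσfix, hσinj, Finset.eq_of_subset_of_card_le ?_ ?_⟩
  · intro z hz
    obtain ⟨i, -, rfl⟩ := Finset.mem_image.mp hz
    exact apply_kleinJ_mem_kleinJ_heckeNeighbours_of_fix ι hℓ hℓN hfix hx' (hσfix i)
  · rw [Finset.card_image_of_injective _ hσinj, Finset.card_univ, Fintype.card_fin]
    exact card_kleinJ_heckeNeighbours_le _

/-- **The set of `j`-values of `T_ℓ(x)` has exactly `ℓ + 1` elements** (same hypotheses).
[cite: GrossLMS1991, §3 (proof of Prop. 3.7: T_ℓ(x_m) of degree ℓ + 1)] -/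
theorem card_kleinJ_heckeNeighbours_of_fix (hK : IsImaginaryQuadratic K)
    (ι : K →+* ℂ) {f ℓ : ℕ} (hℓ : ℓ.Prime) (hinert : (Ideal.span {(ℓ : 𝓞 K)}).IsPrime)
    (hℓN : ¬ ℓ ∣ N) (hℓf : ¬ ℓ ∣ f) (hf : f ≠ 0) (hunits : 2 ≤ f ∨ NumberField.discr K < -4)
    [NeZero ℓ] {x : ℍ}
    (hfix : ∀ σ : ℂ ≃+* ℂ, (∀ z ∈ ringClassField K ι f, σ z = z) → LevelTransport N σ x x)
    {Q' : ℤ × ℤ × ℤ} (hQ'1 : 0 < Q'.1) (hQ'prim : IsPrimitive Q')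
    (hQ'disc : discr Q' = ((ℓ * f : ℕ) : ℤ) ^ 2 * NumberField.discr K)
    (hx' : IsHeckeNeighbour N ℓ x (heegnerTau Q')) :
    ((Finset.range ℓ).image (fun j : ℕ => kleinJ (tpB ℓ (j : ℤ) • x)) ∪ {kleinJ (tpD ℓ • x)}).card =
      ℓ + 1 := by
  classical
  obtain ⟨σ, -, hσinj, himage⟩ := exists_image_kleinJ_eq_kleinJ_heckeNeighbours_of_fix hK ι hℓ hinert
    hℓN hℓf hf hunits hfix hQ'1 hQ'prim hQ'disc hx'
  rw [← himage, Finset.card_image_of_injective _ hσinj, Finset.card_univ, Fintype.card_fin]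

end Orbit

end Literature.NumberTheory.EllipticCurves

end
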